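import Summits.SmoothPoincare4.SmoothPoincare4.Theorems.EntropyRungSubcylindricalExistenceSmoothedConeModelMetric
import Summits.SmoothPoincare4.SmoothPoincare4.Theorems.EntropyRungSubcylindricalExistenceSmoothedConeModelProfile
import Summits.SmoothPoincare4.SmoothPoincare4.Theorems.EntropyRungSubcylindricalExistenceSmoothedConeModelDistance
import Summits.SmoothPoincare4.SmoothPoincare4.Theorems.EntropyRungSubcylindricalExistenceSmoothedConeModelVolume
import HarnessLib

/-!
# The smoothed cone of slope `c` as a complete `Ric ≥ 0` metric on `ℝ⁴` of AVR `c³`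
(stub `helper_smoothedConeModel`, W3a of line `fat-conical-core-avr-logsobolev`, crux
`EntropyRung.SubcylindricalExistence`, item stmt-SmoothPoincare4-10871)

**Statement (`helper_smoothedConeModel`).** For every slope `c ∈ (0, 1]` there is a smooth
Riemannian metric `g_c` on `ℝ⁴ = EuclideanSpace ℝ (Fin 4)` with Levi-Civita connection such that
(i) closed `g_c`-distance balls are compact (completeness), (ii) `Ric(g_c) ≥ 0`,
(iii) `Vol_{g_c}{d(x,·) ≤ r} / (π² r⁴/2) → c³` as `r → ∞` at every point `x` (asymptotic volume
ratio `c³`), and (iv) `g_c = (c‖x‖^{c−1})² δ` for `‖x‖ ≥ 1` — the exact cone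
`dr² + c² r² g_{S³}`, `r = ‖x‖^c`, outside the unit ball.

**Proof (assembly of the four aux files).** `g_c = e^{2θ(‖x‖²)} δ` with the profile `θ` of
`…SmoothedConeModelProfile` (`θ = log c + ((c−1)/2) log` on `[1,∞)`, `sθ' ∈ [(c−1)/2, 0]`
nonincreasing); `…SmoothedConeModelMetric` realises it with `Ric ≥ 0` (Besse 1987, Thm. 1.159 (d));
`…SmoothedConeModelDistance` gives `‖y‖^c − C ≤ d(0,y) ≤ ‖y‖^c + C`, whence closed balls are
closed (continuity of `d`) and bounded, hence compact, and the `d`-balls about any `x` are squeezed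
between cone annuli `{1 ≤ ‖y‖, ‖y‖^c ≤ r ∓ K}` (up to the unit ball); `…SmoothedConeModelVolume`
computes their volumes `(π²/2) c³ ((r ∓ K)⁴ − 1)`, and the ratio to `π² r⁴/2` tends to `c³` by the
squeeze theorem. Everything is proved; no definition, no named fact.

References: A. L. Besse, *Einstein Manifolds* (1987), Thm. 1.159 [Besse1987]; P. Petersen,
*Riemannian Geometry*, 3rd ed. (2016), §4.2.3 [Petersen2016]; Z. M. Balogh, A. Kristály,
F. Tripaldi, *Sharp log-Sobolev inequalities in `CD(0,N)` spaces*, arXiv:2210.15774, Thm. 1.1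
(the consumer of this model) [BaloghKristalyTripaldi2022].
-/

noncomputable section

-- the registered namespace `Summit.SmoothPoincare4.SmoothPoincare4.Theorems` repeats a component
set_option linter.dupNamespace false

open scoped Manifold ContDiff Topology RealInnerProductSpace ENNReal NNReal
open Set Filter Function MeasureTheory Metric
open Literature.Geometry.Lorentzian Literature.Geometry.Riemannian

namespace Summit.SmoothPoincare4.SmoothPoincare4.Theorems

namespace SmoothedConeModel

/-! ## The squeeze for the volume ratio -/

/-- **Asymptotic volume ratio from two-sided annulus bounds.** If for large `r` an extended
quantity `V(r)` satisfies `(π²/2) c³ ((r−K)⁴ − 1) ≤ V(r) ≤ m₁ + (π²/2) c³ ((r+K)⁴ − 1)` with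
`m₁ < ∞`, then `V(r)/(π² r⁴/2) → c³`. [folklore] -/
theorem tendsto_ratio_of_bounds {V : ℝ → ℝ≥0∞} {c K r₀ : ℝ} {m₁ : ℝ≥0∞} (hm₁ : m₁ ≠ ⊤)
    (hc : 0 ≤ c) (hr₀ : |K| + 1 ≤ r₀)
    (hlow : ∀ r, r₀ ≤ r → ENNReal.ofReal (Real.pi ^ 2 / 2 * c ^ 3 * ((r - K) ^ 4 - 1)) ≤ V r)
    (hup : ∀ r, r₀ ≤ r → V r ≤ m₁ + ENNReal.ofReal (Real.pi ^ 2 / 2 * c ^ 3 * ((r + K) ^ 4 - 1))) :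
    Tendsto (fun r ↦ (V r).toReal / (Real.pi ^ 2 / 2 * r ^ 4)) atTop (𝓝 (c ^ 3)) := by
  have hP : 0 < Real.pi ^ 2 / 2 := by positivity
  have hKabs : -|K| ≤ K ∧ K ≤ |K| := abs_le.1 le_rfl
  -- the two comparison functions and their limits
  have hi : Tendsto (fun r : ℝ ↦ r⁻¹) atTop (𝓝 0) := tendsto_inv_atTop_zero
  have hg : Tendsto (fun r : ℝ ↦ Real.pi ^ 2 / 2 * c ^ 3 * ((r - K) ^ 4 - 1) / (Real.pi ^ 2 / 2 * r ^ 4))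
      atTop (𝓝 (c ^ 3)) := by
    have h := tendsto_const_nhds (x := c ^ 3) |>.mul
      (((tendsto_const_nhds (x := (1 : ℝ))).sub (tendsto_const_nhds (x := K) |>.mul hi)).pow 4 |>.sub
        (hi.pow 4))
    rw [show c ^ 3 * ((1 - K * 0) ^ 4 - (0 : ℝ) ^ 4) = c ^ 3 by norm_num] at h
    refine h.congr' ?_
    filter_upwards [eventually_gt_atTop 0] with r hr
    field_simp
  have hh : Tendsto (fun r : ℝ ↦ (m₁.toReal + Real.pi ^ 2 / 2 * c ^ 3 * ((r + K) ^ 4 - 1)) /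
      (Real.pi ^ 2 / 2 * r ^ 4)) atTop (𝓝 (c ^ 3)) := by
    have h := ((tendsto_const_nhds (x := m₁.toReal / (Real.pi ^ 2 / 2))).mul (hi.pow 4)).add
      (tendsto_const_nhds (x := c ^ 3) |>.mul
        (((tendsto_const_nhds (x := (1 : ℝ))).add (tendsto_const_nhds (x := K) |>.mul hi)).pow 4 |>.sub
          (hi.pow 4)))
    rw [show m₁.toReal / (Real.pi ^ 2 / 2) * (0 : ℝ) ^ 4 + c ^ 3 * ((1 + K * 0) ^ 4 - (0 : ℝ) ^ 4) =
      c ^ 3 by norm_num] at h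
    refine h.congr' ?_
    filter_upwards [eventually_gt_atTop 0] with r hr
    field_simp
  refine tendsto_of_tendsto_of_tendsto_of_le_of_le' hg hh ?_ ?_
  · filter_upwards [eventually_ge_atTop r₀] with r hr
    have hr1 : 1 ≤ r - K := by linarith [hKabs.2]
    have hr2 : 1 ≤ r + K := by linarith [hKabs.1]
    have hr0 : 0 < r := by linarith [abs_nonneg K]
    have hX : 0 ≤ Real.pi ^ 2 / 2 * c ^ 3 * ((r + K) ^ 4 - 1) := by
      have : (1 : ℝ) ≤ (r + K) ^ 4 := one_le_pow₀ hr2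
      have : 0 ≤ c ^ 3 := pow_nonneg hc 3
      positivity
    have hfin : V r ≠ ⊤ :=
      ne_top_of_le_ne_top (ENNReal.add_ne_top.2 ⟨hm₁, ENNReal.ofReal_ne_top⟩) (hup r hr)
    have h1 : Real.pi ^ 2 / 2 * c ^ 3 * ((r - K) ^ 4 - 1) ≤ (V r).toReal :=
      (ENNReal.ofReal_le_iff_le_toReal hfin).1 (hlow r hr)
    exact div_le_div_of_nonneg_right h1 (by positivity)
  · filter_upwards [eventually_ge_atTop r₀] with r hr
    have hr2 : 1 ≤ r + K := by linarith [hKabs.1]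
    have hr0 : 0 < r := by linarith [abs_nonneg K]
    have hX : 0 ≤ Real.pi ^ 2 / 2 * c ^ 3 * ((r + K) ^ 4 - 1) := by
      have : (1 : ℝ) ≤ (r + K) ^ 4 := one_le_pow₀ hr2
      have : 0 ≤ c ^ 3 := pow_nonneg hc 3
      positivity
    have htop : m₁ + ENNReal.ofReal (Real.pi ^ 2 / 2 * c ^ 3 * ((r + K) ^ 4 - 1)) ≠ ⊤ :=
      ENNReal.add_ne_top.2 ⟨hm₁, ENNReal.ofReal_ne_top⟩
    have h1 : (V r).toReal ≤ m₁.toReal + Real.pi ^ 2 / 2 * c ^ 3 * ((r + K) ^ 4 - 1) := by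
      have h := ENNReal.toReal_mono htop (hup r hr)
      rwa [ENNReal.toReal_add hm₁ ENNReal.ofReal_ne_top, ENNReal.toReal_ofReal hX] at h
    exact div_le_div_of_nonneg_right h1 (by positivity)

/-! ## Annulus sandwiches for distance balls -/

variable {c C : ℝ}
  {gc : PseudoRiemannianMetric 𝓘(ℝ, EuclideanFour) ∞ EuclideanFour
    (TangentSpace 𝓘(ℝ, EuclideanFour) : EuclideanFour → Type _)}
  {hgc : gc.IsRiemannian}
  (hup : ∀ y : EuclideanFour, gc.edist hgc 0 y ≤ ENNReal.ofReal (‖y‖ ^ c + C))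
  (hlow : ∀ y : EuclideanFour, ENNReal.ofReal (‖y‖ ^ c - C) ≤ gc.edist hgc 0 y)

include hup in
/-- The distance from the origin is finite. [folklore] -/
theorem edist_zero_ne_top (x : EuclideanFour) : gc.edist hgc 0 x ≠ ⊤ :=
  ne_top_of_le_ne_top ENNReal.ofReal_ne_top (hup x)

include hup hlow in
/-- **Closed distance balls are bounded**: `{d(x,·) ≤ r} ⊆ B̄(0, R)` for some `R`. [folklore] -/
theorem setOf_edist_le_subset_closedBall (hc : 0 < c) (x : EuclideanFour) (r : ℝ≥0) :
    ∃ R : ℝ, {y : EuclideanFour | gc.edist hgc x y ≤ r} ⊆ closedBall 0 R := by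
  set B : ℝ := |‖x‖ ^ c + C| + r with hB
  have hB0 : 0 ≤ B := by positivity
  refine ⟨max 1 ((B + C) ^ c⁻¹), fun y hy ↦ ?_⟩
  rw [mem_closedBall, dist_zero_right]
  have h1 : gc.edist hgc 0 y ≤ ENNReal.ofReal B := by
    calc gc.edist hgc 0 y ≤ gc.edist hgc 0 x + gc.edist hgc x y :=
        PseudoRiemannianMetric.edist_triangle hgc _ _ _
      _ ≤ ENNReal.ofReal |‖x‖ ^ c + C| + ENNReal.ofReal r :=
          add_le_add ((hup x).trans (ENNReal.ofReal_le_ofReal (le_abs_self _)))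
            (by rw [ENNReal.ofReal_coe_nnreal]; exact hy)
      _ = ENNReal.ofReal B := by
          rw [hB]
          exact (ENNReal.ofReal_add (abs_nonneg _) (NNReal.coe_nonneg r)).symm
  have h2 : ‖y‖ ^ c - C ≤ B := (ENNReal.ofReal_le_ofReal_iff hB0).1 ((hlow y).trans h1)
  rcases le_or_gt ‖y‖ 1 with hy1 | hy1
  · exact hy1.trans (le_max_left _ _)
  · have h3 : 1 ≤ ‖y‖ ^ c := Real.one_le_rpow hy1.le hc.le
    have hBC : 0 ≤ B + C := by linarith
    exact ((Real.le_rpow_inv_iff_of_pos (norm_nonneg y) hBC hc).2 (by linarith)).trans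
      (le_max_right _ _)

include hup in
/-- **Inner annulus**: `{1 ≤ ‖y‖, ‖y‖^c ≤ r − d(0,x) − C} ⊆ {d(x,·) ≤ r}` for `r ≥ d(0,x)`. [folklore] -/
theorem annulus_subset_setOf_edist_le (x : EuclideanFour) {r : ℝ}
    (hr : (gc.edist hgc 0 x).toReal ≤ r) :
    {y : EuclideanFour | 1 ≤ ‖y‖ ∧ ‖y‖ ^ c ≤ r - ((gc.edist hgc 0 x).toReal + C)} ⊆
      {y | gc.edist hgc x y ≤ ENNReal.ofReal r} := by
  intro y hy
  set d : ℝ := (gc.edist hgc 0 x).toReal with hd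
  have hdx : gc.edist hgc 0 x = ENNReal.ofReal d := (ENNReal.ofReal_toReal (edist_zero_ne_top hup x)).symm
  have hd0 : 0 ≤ d := ENNReal.toReal_nonneg
  calc gc.edist hgc x y ≤ gc.edist hgc x 0 + gc.edist hgc 0 y :=
      PseudoRiemannianMetric.edist_triangle hgc _ _ _
    _ ≤ ENNReal.ofReal d + ENNReal.ofReal (r - d) := by
        refine add_le_add (by rw [PseudoRiemannianMetric.edist_comm hgc, hdx]) ((hup y).trans ?_)
        exact ENNReal.ofReal_le_ofReal (by linarith [hy.2])
    _ = ENNReal.ofReal r := by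
        rw [← ENNReal.ofReal_add hd0 (by linarith)]
        congr 1
        ring

include hup hlow in
/-- **Outer annulus**: `{d(x,·) ≤ r} ⊆ B(0,1) ∪ {1 ≤ ‖y‖, ‖y‖^c ≤ r + d(0,x) + C}` for `r ≥ 0`. [folklore] -/
theorem setOf_edist_le_subset_union (x : EuclideanFour) {r : ℝ} (hr : 0 ≤ r) :
    {y : EuclideanFour | gc.edist hgc x y ≤ ENNReal.ofReal r} ⊆
      ball 0 1 ∪ {y | 1 ≤ ‖y‖ ∧ ‖y‖ ^ c ≤ r + ((gc.edist hgc 0 x).toReal + C)} := by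
  intro y hy
  set d : ℝ := (gc.edist hgc 0 x).toReal with hd
  have hdx : gc.edist hgc 0 x = ENNReal.ofReal d := (ENNReal.ofReal_toReal (edist_zero_ne_top hup x)).symm
  have hd0 : 0 ≤ d := ENNReal.toReal_nonneg
  have h1 : gc.edist hgc 0 y ≤ ENNReal.ofReal (d + r) := by
    calc gc.edist hgc 0 y ≤ gc.edist hgc 0 x + gc.edist hgc x y :=
        PseudoRiemannianMetric.edist_triangle hgc _ _ _
      _ ≤ ENNReal.ofReal d + ENNReal.ofReal r := add_le_add hdx.le hy
      _ = ENNReal.ofReal (d + r) := (ENNReal.ofReal_add hd0 hr).symm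
  have h2 : ‖y‖ ^ c - C ≤ d + r := (ENNReal.ofReal_le_ofReal_iff (by linarith)).1 ((hlow y).trans h1)
  rcases lt_or_ge ‖y‖ 1 with hy1 | hy1
  · exact Or.inl (by rwa [mem_ball, dist_zero_right])
  · exact Or.inr ⟨hy1, by linarith⟩

end SmoothedConeModel

open SmoothedConeModel in
/-- **W3a (stub `helper_smoothedConeModel`): the smoothed cone of slope `c ∈ (0, 1]` as a complete
`Ric ≥ 0` metric on `ℝ⁴` of asymptotic volume ratio `c³`, exactly the cone `c²‖x‖^{2c−2} δ`
outside the unit ball.** `g_c = e^{2θ(‖x‖²)} δ` with `sθ'(s) = ((c−1)/2) m(s)` for a smooth monotone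
step `m` (`0` near `0`, `1` on `[1,∞)`): the radial and tangential Ricci eigenvalues
`−12(θ' + sθ'')`, `−(12θ' + 4sθ'' + 8sθ'²)` are nonnegative (Besse 1987, Thm. 1.159 (d)); the
distance from the origin is `‖y‖^c + O(1)`, so closed balls are compact and, with
`dV = e^{4θ} dy = c⁴‖y‖^{4c−4} dy` outside the unit ball, `Vol{d(x,·) ≤ r} = (π²/2) c³ r⁴ + o(r⁴)`.
[cite: Besse1987, Thm. 1.159 (d)] -/
theorem helper_smoothedConeModel :
    ∀ c' : ℝ, 0 < c' → c' ≤ 1 →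
      ∃ gc : PseudoRiemannianMetric (𝓡 4) ∞ (EuclideanSpace ℝ (Fin 4))
          (TangentSpace (𝓡 4) : EuclideanSpace ℝ (Fin 4) → Type _),
      ∃ _ : gc.HasLeviCivita, ∃ hgc : gc.IsRiemannian,
        (∀ (x : EuclideanSpace ℝ (Fin 4)) (r : NNReal),
          IsCompact {y : EuclideanSpace ℝ (Fin 4) | gc.edist hgc x y ≤ r}) ∧
        (∀ (x : EuclideanSpace ℝ (Fin 4)) (X : TangentSpace (𝓡 4) x), 0 ≤ gc.ricci x X X) ∧
        (∀ x : EuclideanSpace ℝ (Fin 4), Tendsto (fun r : ℝ ↦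
          ((riemannianMeasure (gc.toContMDiffRiemannianMetric hgc))
            {y : EuclideanSpace ℝ (Fin 4) | gc.edist hgc x y ≤ ENNReal.ofReal r}).toReal /
              (Real.pi ^ 2 / 2 * r ^ 4)) atTop (𝓝 (c' ^ 3))) ∧
        ∀ x : EuclideanSpace ℝ (Fin 4), 1 ≤ ‖x‖ → ∀ v w : EuclideanSpace ℝ (Fin 4),
          gc.val x v w = (c' * ‖x‖ ^ (c' - 1)) ^ 2 * ⟪v, w⟫ := by
  intro c hc hc1
  obtain ⟨θ, Ψ, hθ, hΨ, hθcone, hΨcone, hlip, hR, hT⟩ := helper_smoothedConeModel_profile c hc hc1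
  obtain ⟨gc, hLC, hgc, hval, hric⟩ := helper_smoothedConeModel_metric θ hθ hR hT
  obtain ⟨C, hup, hlow⟩ :=
    helper_smoothedConeModel_distance c hc θ Ψ hθ hΨ hθcone hΨcone hlip gc hgc hval
  obtain ⟨hball, hann⟩ := helper_smoothedConeModel_volume c hc θ hθ hθcone gc hgc hval
  refine ⟨gc, hLC, hgc, fun x r ↦ ?_, hric, fun x ↦ ?_, fun x hx v w ↦ ?_⟩
  · -- (i) closed balls are closed and bounded, hence compact
    obtain ⟨R, hR⟩ := setOf_edist_le_subset_closedBall hup hlow hc x r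
    have hclosed : IsClosed {y : EuclideanSpace ℝ (Fin 4) | gc.edist hgc x y ≤ r} :=
      isClosed_le ((PseudoRiemannianMetric.continuous_edist hgc).comp (Continuous.prodMk_right x))
        continuous_const
    exact (isCompact_closedBall (0 : EuclideanSpace ℝ (Fin 4)) R).of_isClosed_subset hclosed hR
  · -- (iii) the volume ratio, squeezed between two cone annuli
    set μ : Measure (EuclideanSpace ℝ (Fin 4)) := riemannianMeasure (gc.toContMDiffRiemannianMetric hgc)
      with hμ
    set K : ℝ := (gc.edist hgc 0 x).toReal + C with hK
    have hd0 : 0 ≤ (gc.edist hgc 0 x).toReal := ENNReal.toReal_nonneg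
    refine tendsto_ratio_of_bounds (V := fun r ↦ μ {y | gc.edist hgc x y ≤ ENNReal.ofReal r})
      (K := K) (r₀ := |K| + (gc.edist hgc 0 x).toReal + 1) hball.ne hc.le (by linarith)
      (fun r hr ↦ ?_) (fun r hr ↦ ?_)
    · have hKabs : K ≤ |K| := le_abs_self K
      have h1 : 1 ≤ r - K := by linarith
      rw [← hann (r - K) h1]
      exact measure_mono (annulus_subset_setOf_edist_le hup x (by linarith [abs_nonneg K]))
    · have hKabs : -|K| ≤ K := neg_abs_le K
      have h1 : 1 ≤ r + K := by linarith
      have hr0 : 0 ≤ r := by linarith [abs_nonneg K]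
      rw [← hann (r + K) h1]
      exact (measure_mono (setOf_edist_le_subset_union hup hlow x hr0)).trans (measure_union_le _ _)
  · -- (iv) the exact cone outside the unit ball
    have hx0 : 0 < ‖x‖ := lt_of_lt_of_le one_pos hx
    rw [hval, hθcone _ (by nlinarith), Real.log_pow]
    congr 1
    push_cast
    rw [show 2 * (Real.log c + (c - 1) / 2 * (2 * Real.log ‖x‖)) =
        ((2 : ℕ) : ℝ) * (Real.log c + Real.log ‖x‖ * (c - 1)) by push_cast; ring,
      Real.exp_nat_mul, Real.exp_add, Real.exp_log hc, ← Real.rpow_def_of_pos hx0]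

end Summit.SmoothPoincare4.SmoothPoincare4.Theorems
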